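import Mathlib
import HarnessLib
import Literature.Analysis.FluidPDE.SelfSimilar
import Literature.Analysis.FluidPDE.VectorCalculus
import Literature.Analysis.FluidPDE.Vorticity
import Literature.Analysis.FluidPDE.AxisymmetricEuler

/-!
# Route `UnthreadedDoor`, crux `PoloidalLiouville` (stmt-NavierStokesRegularity-1222), WALL W1 `stub_scalarLiouville` —
# crux idea «capsym-comparison» (ns-idea-13 g0; idea-crit-7 backstop verdict PASS-WITH-PRICE P1–P4, KEY-NS #150):
# THE TYPED STATEMENTS of the two Lean-level line inputs FL-A / FL-C

Definition file (Theorems-side twin of the crux sketch `Cruxes/PoloidalLiouville/CapsymComparisonSketch.lean`, tree sha12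
6f362c10523f, 2026-08-28T16:12:16Z; namespace `…Theorems.PoloidalLiouville.CapSym` instead of the sketch's
`…Cruxes.PoloidalLiouville.CapSym`; the def BODIES are VERBATIM).  Only FL-A and FL-C are typed here (KEY-NS #150 (2):
«not FL-B, not the RUNG»); the Theses import of the sketch is dropped (nothing below needs it).

* `CapSym.HeadPotentialExists` (FL-A, support, S/M) — the vortical head potential: the conservative form of hypothesis (E1)
  of `StubScalarLiouville` by the Poincaré lemma on `ℝ³ ∖ {x₀}`.  PROVED in `…UnthreadedDoorCapSymHeadPotential`.
* `CapSym.ZonalToroidalLiouville` (FL-C, the comparison end-point, M–L) — the linear heart of KNSS Thm 5.2 with a GIVEN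
  zonal swirl-free drift.

WHAT THIS IS NOT: no NS-regularity statement is touched; `PoloidalLiouville` (1222) and its wall `stub_scalarLiouville` stay
OPEN; these are INPUTS of one crux idea card.  `--supports stmt-NavierStokesRegularity-1222 --as helper`.
[cite: KochNadirashviliSereginSverak2009, Thm 5.2 (Acta Math. 203, p. 97)]
-/

noncomputable section

-- the summit and its single sub-problem share the name (CONVENTIONS §1)
set_option linter.dupNamespace false

namespace Summit.NavierStokesRegularity.NavierStokesRegularity.Theorems.PoloidalLiouville.CapSym

open scoped BigOperators Topology InnerProductSpace RealInnerProductSpace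
open Set Function MeasureTheory Literature.Analysis.FluidPDE

/-- (FL-A, support, S/M) **Vortical head potential.**  Frozen-time Poincaré lemma behind the conservative
form (★): if `∇L × (x − x₀) = ∇m × ∇T` off `x₀` (this is hypothesis (E1) of `StubScalarLiouville` with
`L = 𝓛T`, `m = ⟪v, x − x₀⟫`), then the field `L·(x − x₀) − m ∇T` is curl-free on the simply connected
`ℝ³ ∖ {x₀}`, hence `= −∇Π` for a `C¹` "head" `Π`; tangentially `∇_S Π = m ∇_S T` (so `Π` and `m` are constant
on the vortex loops `{T = c} ∩ S_r`), radially `r·L = m ∂_r T − ∂_r Π`. -/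
def HeadPotentialExists : Prop :=
  ∀ (x₀ : EuclideanSpace ℝ (Fin 3)) (L m T : EuclideanSpace ℝ (Fin 3) → ℝ),
    ContDiffOn ℝ 1 L ({x₀}ᶜ) → ContDiffOn ℝ 1 m ({x₀}ᶜ) → ContDiffOn ℝ 2 T ({x₀}ᶜ) →
    (∀ x, x ≠ x₀ → cross (gradient L x) (x - x₀) = cross (gradient m x) (gradient T x)) →
    ∃ P : EuclideanSpace ℝ (Fin 3) → ℝ, ContDiffOn ℝ 1 P ({x₀}ᶜ) ∧
      ∀ x, x ≠ x₀ → (L x) • (x - x₀) = (m x) • gradient T x - gradient P x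

/-- (FL-C, the comparison END-POINT, L) **Zonal toroidal Liouville = the linear heart of KNSS Thm 5.2.**
A bounded-with-derivatives zonal (axisymmetric about `e₂`) toroidal field `B = ∇U × x` (`U` a zonal scalar
potential) transported on `(−∞,0) × ℝ³` by a GIVEN smooth bounded divergence-free axisymmetric swirl-free
velocity `V` — induction equation in un-curled potential form `(∂ₜU + V·∇U − ΔU)·x = ⟪V,x⟫ ∇U − ∇Π` —
vanishes identically.  Proof route: `η̃ := B_φ/ϖ` solves `∂ₜη̃ + V·∇η̃ = Δ₅ η̃` (the `SO(4)`-lift,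
`AxisymmetricLiftR5`) with `|ϖ η̃| ≤ K`, and `KNSS2009_lemma21_halfball.eq_zero_of_abs_mul_le` ends it.
This is what the cap-symmetrised comparison flow must satisfy; KNSS 5.2 itself is the case `V = v`, `U = T`. -/
def ZonalToroidalLiouville : Prop :=
  ∀ (V : ℝ → EuclideanSpace ℝ (Fin 3) → EuclideanSpace ℝ (Fin 3)) (U P : ℝ → EuclideanSpace ℝ (Fin 3) → ℝ),
    ContDiffOn ℝ (⊤ : ℕ∞) (uncurry V) (Iio 0 ×ˢ univ) →
    ContDiffOn ℝ (⊤ : ℕ∞) (uncurry U) (Iio 0 ×ˢ univ) →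
    ContDiffOn ℝ 1 (uncurry P) (Iio 0 ×ˢ univ) →
    (∀ n : ℕ, ∃ C : ℝ, ∀ t < 0, ∀ x, ‖iteratedFDeriv ℝ n (V t) x‖ ≤ C) →
    (∀ t < 0, VectorCalculus.IsDivFree (V t)) →
    (∀ t < 0, IsAxisymmetric (V t)) → (∀ t < 0, HasNoSwirl (V t)) →
    (∀ t < 0, IsAxisymmetricScalar (U t)) →
    (∀ n : ℕ, ∃ C : ℝ, ∀ t < 0, ∀ x,
        ‖iteratedFDeriv ℝ n (fun z => cross (gradient (U t) z) z) x‖ ≤ C) →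
    (∀ t < 0, ∀ x,
        (deriv (fun s => U s x) t + inner ℝ (V t x) (gradient (U t) x) - Laplacian.laplacian (U t) x) • x
          = (inner ℝ (V t x) x) • gradient (U t) x - gradient (P t) x) →
    ∀ t < 0, ∀ x, cross (gradient (U t) x) x = 0

end Summit.NavierStokesRegularity.NavierStokesRegularity.Theorems.PoloidalLiouville.CapSym

end
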